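import Summits.ValiantsHypothesis.ValiantsHypothesis.Theorems.NewtonUnitEquationsTwoProductsSubmergedDefs
import HarnessLib

/-!
# TwoShiftToy (val-idea-37 g5) — the first «≥ 2-shift» toy statement for crux 5906 `TwoProducts`

Crux-workfile sketch (director-valiant R330 (2c); critic val-idea-crit-8 g3).  Typed statements,
two routine implications, the join lemma (`joinLemma_holds`, rev 2) and the join-grid
disjointness (`join_above_points_and_meets`, rev 3) kernel-proved; the decided toy cases are in the memo
`Cruxes/TwoProducts/TwoShiftToy-val-idea-37-g5.md` §2 (hand proof ∀ N, exact machine check N = 4 … 20).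

* `OneProductCellLaw a b` — THE TOY STATEMENT: the per-cell law `CellLaw a b` restricted to `v = 0`
  (one product plus a constant, `∏ (1+u_j) − 1`).  This is KPTT's second open problem
  ("edges of Newt(f₁⋯f_m + 1) … the true bound could be 2^{O(m)} t^{O(1)}", arXiv:1308.2286 §5) in the
  line's per-cell normal form; `CellLaw a b → OneProductCellLaw a b` (proved below).
* `toyU N` — an explicit `m = 2`, `v = 0` family on TWO INDEPENDENT SHIFT DIRECTIONS `(1,0), (0,1)` over the
  NON-DISSOCIATED carrier pair `{E₀, 2E₀}` (cross-size relation `E₀ + E₀ = 2E₀`):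
  `u₁ = Σ_{i=1}^{N} X^{e_i}`, `u₂ = −u₁ + [u₁²]_{layers i+k ≤ N}`, `e_i = (i², y_i)`.
* `PerCellGrowth` — ONE weak-order cell of `toyU N` carries `N/2` visible points while `t = (N/2+1)² − 1`:
  per-cell counts on the class side are NOT `t`-free (`#S = √(t+1) − 1`), so no law of record-engine shape
  (t-free per cell: R9–R13♯, `MomentRecordCount`, hidden ≤ 12) can hold class-side; `PerCellGrowth → ¬ TFreeCellLaw`
  (proved below).
* `JoinLemma` / `joinLemma_holds` ✓ — the class-side structure that survives every shift and every lumping: two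
  same-side-represented visible points of one cell are incomparable in the product order and their JOIN is a cancelled
  point above both (KERNEL-PROVED here from `IsCellFamily`, `ValidWeight` and the tree's `stub_logLinearisation`).

VP ≠ VNP is NOT proved; nothing here touches `TwoProducts` / `PlanarCellBound` / `ResidualLawV25`.
-/

open MvPolynomial Finsupp
open Summit.ValiantsHypothesis.ValiantsHypothesis.Theorems.NewtonUnitEquations.TwoProducts.FormalLogLinearisation
open Summit.ValiantsHypothesis.ValiantsHypothesis.Theorems.NewtonUnitEquations.TwoProducts.PlanarCell
open Summit.ValiantsHypothesis.ValiantsHypothesis.Theorems.NewtonUnitEquations.TwoProducts.Submerged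

namespace Summit.ValiantsHypothesis.ValiantsHypothesis.Cruxes.TwoProducts.TwoShiftToy

noncomputable section

/-! ## 1. The toy statement: one product plus a constant, per cell -/

/-- **ONE-PRODUCT CELL LAW** (`v = 0`): every weak-order cell family of a normalised one-product instance
`∏_{j<m} (1 + u_j) − 1` (`|supp u_j| ≤ t`) has at most `2^{a m} (t+2)^b` points.  KPTT arXiv:1308.2286 §5,
second open problem, in the per-cell normal form of the `relation_ladder` line. -/
def OneProductCellLaw (a b : ℕ) : Prop :=
  ∀ (m t : ℕ), 2 ≤ t → ∀ (u : Fin m → MvPolynomial (Fin 2) ℂ),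
    (∀ j, coeff 0 (u j) = 0 ∧ (u j).support.card ≤ t) →
    ∀ (R : Expo → Expo → Prop) (S : Finset Expo),
      IsCellFamily u (fun _ => (0 : MvPolynomial (Fin 2) ℂ)) R S → S.card ≤ 2 ^ (a * m) * (t + 2) ^ b

/-- The toy statement is a special case of the line's per-cell law. -/
theorem oneProductCellLaw_of_cellLaw (a b : ℕ) (h : CellLaw a b) : OneProductCellLaw a b := by
  intro m t ht u hu R S hS
  refine h m t ht u (fun _ => 0) hu ?_ R S hS
  intro j
  refine ⟨by simp, ?_⟩
  simp

/-- A `t`-FREE per-cell law (the shape of every record/carrier law of the ladder: the count per weak-order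
cell depends on `m` only). -/
def TFreeCellLaw : Prop :=
  ∃ c : ℕ → ℕ, ∀ (m t : ℕ), 2 ≤ t → ∀ (u v : Fin m → MvPolynomial (Fin 2) ℂ),
    (∀ j, coeff 0 (u j) = 0 ∧ (u j).support.card ≤ t) → (∀ j, coeff 0 (v j) = 0 ∧ (v j).support.card ≤ t) →
    ∀ (R : Expo → Expo → Prop) (S : Finset Expo), IsCellFamily u v R S → S.card ≤ c m

/-! ## 2. The explicit two-shift family (`m = 2`, `v = 0`) -/

/-- Scale constants of the family: `R = 100 N⁴`, `D = R·2^{N+3}`, `M = 8 N D`. -/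
def cR (N : ℕ) : ℕ := 100 * N ^ 4
def cD (N : ℕ) : ℕ := cR N * 2 ^ (N + 3)
def cM (N : ℕ) : ℕ := 8 * N * cD N

/-- Depth of the `i`-th letter: `y_i = M + i D + R 2^{N+1-i} + (i(N+1-i))² − R 2^i` (no truncation: `M ≫ R 2^N`). -/
def depth (N i : ℕ) : ℕ :=
  (cM N + i * cD N + cR N * 2 ^ (N + 1 - i) + (i * (N + 1 - i)) ^ 2) - cR N * 2 ^ i

/-- The `i`-th letter `e_i = (i², y_i) = E₀ + i²·(1,0) + (y_i − y(E₀))·(0,1)`: two independent shift directions. -/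
def letter (N i : ℕ) : Expo := single 0 (i ^ 2) + single 1 (depth N i)

/-- `u₁ = Σ_{i=1}^{N} X^{e_i}` (all coefficients `1`). -/
def u1 (N : ℕ) : MvPolynomial (Fin 2) ℂ :=
  ∑ i ∈ Finset.Icc 1 N, monomial (letter N i) 1

/-- The layers `i + k ≤ N` of `u₁²`, as a polynomial: `s = Σ_{1 ≤ i ≤ k, i+k ≤ N} (2 − δ_{ik}) X^{e_i + e_k}`.
Its letters sit on the carrier `2E₀` — the cross-size relation `E₀ + E₀ = 2E₀` is the whole point. -/
def sLow (N : ℕ) : MvPolynomial (Fin 2) ℂ :=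
  ∑ p ∈ ((Finset.Icc 1 N) ×ˢ (Finset.Icc 1 N)).filter (fun p => p.1 ≤ p.2 ∧ p.1 + p.2 ≤ N),
    monomial (letter N p.1 + letter N p.2) (if p.1 = p.2 then 1 else 2)

/-- `u₂ = −u₁ + s`: kills every letter of `u₁` and every point of `u₁²` on the layers `i + k ≤ N`. -/
def u2 (N : ℕ) : MvPolynomial (Fin 2) ℂ := sLow N - u1 N

/-- The instance `(u₁, u₂)` with `v = 0`, i.e. `tailDiff = (1+u₁)(1+u₂) − 1 = s(1+u₁) − u₁²`. -/
def toyU (N : ℕ) : Fin 2 → MvPolynomial (Fin 2) ℂ := ![u1 N, u2 N]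

/-- `v = 0`. -/
def toyV : Fin 2 → MvPolynomial (Fin 2) ℂ := fun _ => 0

/-- The visible chain: the diagonal layer `p_i = e_i + e_{N+1-i}`, `1 ≤ i ≤ N/2`. -/
def chain (N : ℕ) : Finset Expo :=
  (Finset.Icc 1 (N / 2)).image fun i => letter N i + letter N (N + 1 - i)

/-- The reference weight `ξ₀ = (−(3N−2), −1)` (the top tie of the chain); the cell is the weak order it induces on
the tail letters, constant on the whole window `θ ∈ (−N²/2 − 1, −3N + 3)` that contains every tie of the chain. -/
def xi0 (N : ℕ) : Fin 2 → ℝ := ![-(3 * (N : ℝ) - 2), -1]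

/-- The cell's weak order on exponents. -/
def toyOrder (N : ℕ) (e e' : Expo) : Prop := wt (xi0 N) e ≤ wt (xi0 N) e'

/-- **PER-CELL GROWTH (decided: hand proof ∀ N in the memo §2; exact machine check `N = 4,…,20`).**
For even `N ≥ 4` the diagonal layer is a cell family of the weak order `toyOrder N` with `N/2` points, while the
instance is normalised with `|supp u₁| = N`, `|supp u₂| = (N/2+1)² − 1 =: t`; i.e. `#S = √(t+1) − 1` in ONE cell. -/
def PerCellGrowth : Prop :=
  ∀ N : ℕ, 4 ≤ N → Even N →
    IsCellFamily (toyU N) toyV (toyOrder N) (chain N) ∧ (chain N).card = N / 2 ∧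
    (∀ j, coeff 0 (toyU N j) = 0) ∧ (u1 N).support.card = N ∧ (u2 N).support.card = (N / 2 + 1) ^ 2 - 1

/-- Per-cell growth kills every `t`-free per-cell law (so the `(t+2)^b` of `CellLaw` is load-bearing on the class
side, with `b ≥ 1/2` at `m = 2`). -/
theorem not_tFreeCellLaw_of_perCellGrowth (h : PerCellGrowth) : ¬ TFreeCellLaw := by
  rintro ⟨c, hc⟩
  -- take N even with N/2 > c 2 and t = (N/2+1)^2 - 1 ≥ 2
  set N : ℕ := 2 * (c 2 + 2) with hN
  have hN4 : 4 ≤ N := by omega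
  have hNe : Even N := ⟨c 2 + 2, by omega⟩
  obtain ⟨hcell, hcard, h0, hu1, hu2⟩ := h N hN4 hNe
  have hdiv : N / 2 = c 2 + 2 := by omega
  set t : ℕ := (N / 2 + 1) ^ 2 - 1 with ht
  have ht2 : 2 ≤ t := by
    rw [ht, hdiv]; exact Nat.le_sub_of_add_le (by nlinarith)
  have hNt : N ≤ t := by
    rw [ht, hdiv, hN]; exact Nat.le_sub_of_add_le (by nlinarith)
  have hu : ∀ j, coeff 0 (toyU N j) = 0 ∧ (toyU N j).support.card ≤ t := by
    intro j
    refine ⟨h0 j, ?_⟩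
    fin_cases j
    · simp [toyU, hu1, hNt]
    · simp [toyU, hu2, ht]
  have hv : ∀ j : Fin 2, coeff 0 (toyV j) = 0 ∧ (toyV j).support.card ≤ t := by
    intro j; simp [toyV]
  have := hc 2 t ht2 (toyU N) toyV hu hv (toyOrder N) (chain N) hcell
  rw [hcard, hdiv] at this
  omega

/-! ## 3. The join lemma (class-side structure; any `m`, any lumping, any number of shift directions) -/

variable {m : ℕ}

/-- A `u`-side REPRESENTATION of the point `l`: one letter of `u_j` or `0` per factor, summing to `l`. -/
def URep (u : Fin m → MvPolynomial (Fin 2) ℂ) (τ : Fin m → Expo) (l : Expo) : Prop :=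
  (∀ j, τ j = 0 ∨ τ j ∈ (u j).support) ∧ ∑ j, τ j = l

/-- The JOIN of two representations at the weight `ξ`: factorwise the heavier entry. -/
def join (ξ : Fin 2 → ℝ) (τ τ' : Fin m → Expo) : Expo :=
  ∑ j, if wt ξ (τ j) ≤ wt ξ (τ' j) then τ' j else τ j

/-- **JOIN LEMMA.**  In a cell (weak order `R` on the tail letters), let `l ≠ l'` be two points of the family with
`u`-side representations `τ, τ'`, and let `ξ` be a valid weight inducing `R` at which `l` is the strict top of the
log-support.  Then the join `q = τ ∨_ξ τ'` weighs strictly more than `l` and than `l'` at `ξ`, hence is a CANCELLED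
point: `coeff q (∏(1+u) − ∏(1+v)) = 0` and `q ∉ logSupport`.  (Proof, memo §3: coordinatewise comparisons of
entries of `tailSupport ∪ {0}` are `R`-determined, so `τ' ≤ τ` coordinatewise would give `wt_{ξ'} l' ≤ wt_{ξ'} l`
at the witness `ξ'` of `l'`, contradicting strictness; hence some coordinate is strictly bigger and
`wt_ξ q > wt_ξ l`; `l` strict top at `ξ` and `stub_logLinearisation` finish.)  `N` same-side points of one cell
thus force `N(N−1)/2` cancelled joins — in `toyU N` these are exactly the `N²/4` letters of `s`. -/
def JoinLemma : Prop :=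
  ∀ (m : ℕ) (u v : Fin m → MvPolynomial (Fin 2) ℂ), (∀ j, coeff 0 (u j) = 0) → (∀ j, coeff 0 (v j) = 0) →
    ∀ (R : Expo → Expo → Prop) (S : Finset Expo), IsCellFamily u v R S →
    ∀ l ∈ S, ∀ l' ∈ S, l ≠ l' → ∀ (τ τ' : Fin m → Expo), URep u τ l → URep u τ' l' →
    ∀ ξ : Fin 2 → ℝ, ValidWeight u v ξ → (∀ e ∈ tailSupport u v, ∀ e' ∈ tailSupport u v, (R e e' ↔ wt ξ e ≤ wt ξ e')) →
      IsStrictTop ξ (logSupport u v) l →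
      wt ξ l < wt ξ (join ξ τ τ') ∧ wt ξ l' < wt ξ (join ξ τ τ') ∧
        coeff (join ξ τ τ') (tailDiff u v) = 0 ∧ join ξ τ τ' ∉ logSupport u v

/-- **The join lemma holds** (kernel proof of `JoinLemma`; class-side, no carrier / level / direction used). -/
theorem joinLemma_holds : JoinLemma := by
  classical
  intro m u v hu0 hv0 R S hS l hl l' hl' hne τ τ' hτ hτ' ξ hval hR htop
  -- termwise: the join entry dominates both entries
  have hterm : ∀ j, wt ξ (τ j) ≤ wt ξ (if wt ξ (τ j) ≤ wt ξ (τ' j) then τ' j else τ j) ∧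
      wt ξ (τ' j) ≤ wt ξ (if wt ξ (τ j) ≤ wt ξ (τ' j) then τ' j else τ j) := by
    intro j
    split_ifs with h
    · exact ⟨h, le_rfl⟩
    · exact ⟨le_rfl, le_of_lt (not_le.mp h)⟩
  have hwq : wt ξ (join ξ τ τ') = ∑ j, wt ξ (if wt ξ (τ j) ≤ wt ξ (τ' j) then τ' j else τ j) := by
    simp only [join]
    exact wt_sum ξ Finset.univ _
  have hwl : wt ξ l = ∑ j, wt ξ (τ j) := by
    rw [← hτ.2]; exact wt_sum ξ Finset.univ _
  have hwl' : wt ξ l' = ∑ j, wt ξ (τ' j) := by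
    rw [← hτ'.2]; exact wt_sum ξ Finset.univ _
  have hle : wt ξ l ≤ wt ξ (join ξ τ τ') := by
    rw [hwq, hwl]; exact Finset.sum_le_sum fun j _ => (hterm j).1
  -- membership facts and the witness of l'
  have hl_mem : l ∈ logSupport u v := htop.1
  obtain ⟨ξ', hval', htop', hR'⟩ := hS l' hl'
  have hl'_mem : l' ∈ logSupport u v := htop'.1
  -- strict for l' : l' < l ≤ join at ξ
  have hlt' : wt ξ l' < wt ξ (join ξ τ τ') := by
    have h1 : wt ξ l' < wt ξ l := htop.2 l' hl'_mem (Ne.symm hne)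
    linarith
  -- strict for l : otherwise τ' ≤ τ coordinatewise, which transfers to ξ' and contradicts that l' is the top there
  have hlt : wt ξ l < wt ξ (join ξ τ τ') := by
    by_contra hnot
    have heq : wt ξ (join ξ τ τ') = wt ξ l := le_antisymm (not_lt.mp hnot) hle
    have hteq : ∀ j ∈ (Finset.univ : Finset (Fin m)),
        wt ξ (τ j) = wt ξ (if wt ξ (τ j) ≤ wt ξ (τ' j) then τ' j else τ j) := by
      have h1 : ∑ j, wt ξ (τ j) = ∑ j, wt ξ (if wt ξ (τ j) ≤ wt ξ (τ' j) then τ' j else τ j) := by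
        rw [← hwl, ← hwq, heq]
      exact (Finset.sum_eq_sum_iff_of_le (fun j _ => (hterm j).1)).mp h1
    have hdom : ∀ j, wt ξ (τ' j) ≤ wt ξ (τ j) := fun j =>
      (hterm j).2.trans (le_of_eq (hteq j (Finset.mem_univ j)).symm)
    have hdom' : ∀ j, wt ξ' (τ' j) ≤ wt ξ' (τ j) := by
      intro j
      rcases hτ'.1 j with h0' | hs'
      · rw [h0', wt_zero]
        rcases hτ.1 j with h0 | hs
        · rw [h0, wt_zero]
        · exfalso
          have hneg : wt ξ (τ j) < 0 := hval.1 j (τ j) hs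
          have h2 := hdom j
          rw [h0', wt_zero] at h2
          linarith
      · rcases hτ.1 j with h0 | hs
        · rw [h0, wt_zero]; exact le_of_lt (hval'.1 j (τ' j) hs')
        · have hmem : τ j ∈ tailSupport u v := by
            unfold tailSupport
            exact Finset.mem_union.mpr (Or.inl (Finset.mem_biUnion.mpr ⟨j, Finset.mem_univ j, hs⟩))
          have hmem' : τ' j ∈ tailSupport u v := by
            unfold tailSupport
            exact Finset.mem_union.mpr (Or.inl (Finset.mem_biUnion.mpr ⟨j, Finset.mem_univ j, hs'⟩))
          have hRj : R (τ' j) (τ j) := (hR (τ' j) hmem' (τ j) hmem).mpr (hdom j)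
          exact (hR' (τ' j) hmem' (τ j) hmem).mp hRj
    have hsum : wt ξ' l' ≤ wt ξ' l := by
      rw [← hτ.2, ← hτ'.2, wt_sum ξ' Finset.univ, wt_sum ξ' Finset.univ]
      exact Finset.sum_le_sum fun j _ => hdom' j
    have hstrict : wt ξ' l < wt ξ' l' := htop'.2 l hl_mem hne
    linarith
  have hql : join ξ τ τ' ≠ l := by
    intro h; rw [h] at hlt; exact lt_irrefl _ hlt
  refine ⟨hlt, hlt', ?_, ?_⟩
  · by_contra hne0
    have hq_mem : join ξ τ τ' ∈ ((tailDiff u v).support : Set Expo) := by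
      rw [Finset.mem_coe, MvPolynomial.mem_support_iff]; exact hne0
    have htopT : IsStrictTop ξ ↑(tailDiff u v).support l :=
      (stub_logLinearisation m u v hu0 hv0 ξ hval l).mpr htop
    have h3 := htopT.2 (join ξ τ τ') hq_mem hql
    linarith
  · intro hq_mem
    have h3 := htop.2 (join ξ τ τ') hq_mem hql
    linarith

/-- The MEET of two representations at the weight `ξ`: factorwise the lighter entry (a LOWER cell of the join grid). -/
def meet (ξ : Fin 2 → ℝ) (σ σ' : Fin m → Expo) : Expo :=
  ∑ j, if wt ξ (σ j) ≤ wt ξ (σ' j) then σ j else σ' j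

/-- **JOIN GRID DISJOINTNESS** (kernel).  In the situation of the join lemma, the join of `l, l'` (an UPPER cell)
weighs strictly more than every family point and than every meet of two same-side-represented family points (LOWER
cells); in particular it is none of them.  So the payers of a cancelled join are: a tail letter at that point, another
upper cell, or a pair using letters outside the chosen representations — never a diagonal or lower cell. -/
theorem join_above_points_and_meets :
    ∀ (m : ℕ) (u v : Fin m → MvPolynomial (Fin 2) ℂ), (∀ j, coeff 0 (u j) = 0) → (∀ j, coeff 0 (v j) = 0) →
    ∀ (R : Expo → Expo → Prop) (S : Finset Expo), IsCellFamily u v R S →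
    ∀ l ∈ S, ∀ l' ∈ S, l ≠ l' → ∀ (τ τ' : Fin m → Expo), URep u τ l → URep u τ' l' →
    ∀ ξ : Fin 2 → ℝ, ValidWeight u v ξ →
      (∀ e ∈ tailSupport u v, ∀ e' ∈ tailSupport u v, (R e e' ↔ wt ξ e ≤ wt ξ e')) →
      IsStrictTop ξ (logSupport u v) l →
      ∀ l₁ ∈ S, ∀ l₂ ∈ S, ∀ (σ σ' : Fin m → Expo), URep u σ l₁ → URep u σ' l₂ →
        wt ξ l₁ < wt ξ (join ξ τ τ') ∧ wt ξ (meet ξ σ σ') < wt ξ (join ξ τ τ') ∧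
        join ξ τ τ' ≠ l₁ ∧ join ξ τ τ' ≠ meet ξ σ σ' := by
  classical
  intro m u v hu0 hv0 R S hS l hl l' hl' hne τ τ' hτ hτ' ξ hval hR htop l₁ hl₁ l₂ hl₂ σ σ' hσ hσ'
  have hJ := joinLemma_holds m u v hu0 hv0 R S hS l hl l' hl' hne τ τ' hτ hτ' ξ hval hR htop
  have hlt : wt ξ l < wt ξ (join ξ τ τ') := hJ.1
  -- every family point is in the log-support, hence weighs at most the top `l`
  obtain ⟨ξ₁, -, htop₁, -⟩ := hS l₁ hl₁
  have hl₁_mem : l₁ ∈ logSupport u v := htop₁.1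
  have hl₁_le : wt ξ l₁ ≤ wt ξ l := by
    by_cases h : l₁ = l
    · rw [h]
    · exact le_of_lt (htop.2 l₁ hl₁_mem h)
  -- the meet weighs at most `l₁`
  have hmeet_le : wt ξ (meet ξ σ σ') ≤ wt ξ l₁ := by
    have h1 : wt ξ (meet ξ σ σ') = ∑ j, wt ξ (if wt ξ (σ j) ≤ wt ξ (σ' j) then σ j else σ' j) := by
      simp only [meet]; exact wt_sum ξ Finset.univ _
    have h2 : wt ξ l₁ = ∑ j, wt ξ (σ j) := by rw [← hσ.2]; exact wt_sum ξ Finset.univ _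
    rw [h1, h2]
    refine Finset.sum_le_sum fun j _ => ?_
    split_ifs with h
    · exact le_rfl
    · exact le_of_lt (not_le.mp h)
  have h1 : wt ξ l₁ < wt ξ (join ξ τ τ') := lt_of_le_of_lt hl₁_le hlt
  have h2 : wt ξ (meet ξ σ σ') < wt ξ (join ξ τ τ') := lt_of_le_of_lt (hmeet_le.trans hl₁_le) hlt
  refine ⟨h1, h2, ?_, ?_⟩
  · intro h; rw [h] at h1; exact lt_irrefl _ h1
  · intro h; rw [h] at h2; exact lt_irrefl _ h2

end

end Summit.ValiantsHypothesis.ValiantsHypothesis.Cruxes.TwoProducts.TwoShiftToy
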